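import Literature.AlgebraicGeometry.HodgeTheory.VHSDataSimultaneousDeterminationLocus
import Literature.AlgebraicGeometry.HodgeTheory.VHSDataBoundedHodgeClassesFiniteOverCurve
import HarnessLib

/-!
# Cattani–Deligne–Kaplan over a COMPACT one-dimensional base (no punctures): Theorem 1.1 (both halves), Corollary 1.3 — for one class, for every tensor
# construction, for finite collections — from INTERIOR period charts alone

Topic `Literature/AlgebraicGeometry/HodgeTheory` (namespace `Literature.AlgebraicGeometry.Motives.VHSData[.IsLocallyCharted ∕ .IsLocallyFlatCharted]`),
lane `lit-hodgefound` (seat `p08`, row g59-#15); the PUNCTURE-FREE special case of `VHSDataLocallyChartedLift` §6, `VHSDataLocallyFlatCharted` §5,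
`VHSDataSimultaneousDeterminationLocus`, `VHSDataBoundedHodgeClassesFiniteOverCurve`.  THEOREMS ONLY — no definition, no named fact, no instance
(D-0026 net debt `0`).

PRINTED SOURCE, VERBATIM.  E. Cattani, P. Deligne, A. Kaplan, *On the locus of Hodge classes*, J. AMS 8 (1995) (held text `paper:arxiv-alg-geom_9402009`),
§1 (p. 484): «It follows that the locus `T ⊂ U` where `h` remains of type `(p,p)`, i.e., in `ℱ^p`, is a complex analytic subspace of `U`. … locally on
`S`, `S^{(K)}` is a finite disjoint sum of closed analytic subspaces. … **Theorem 1.1.** `S^{(K)}` is an algebraic variety, finite over `S`.»;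
«**Corollary 1.3.** … The set of points in `S` where some determination of `u` is of type `(0,0)`, is an algebraic subvariety of `S`.»; p. 485: «Let
`S̄` be a smooth compactification of `S` …» — when `S = S̄` IS compact there are no punctures: the local finiteness at the points of `S` and the
compactness of `S` are all that is used (no nilpotent orbit theorem, no unipotent monodromy).

THE STATEMENT FORMALISED.  `S` COMPACT and preconnected (a compact Riemann surface with coordinate discs `ψ a` covering it), the family of ends
EMPTY (`IsEmpty ι`): then `IsLocallyCharted ψ σ` ∕ `IsLocallyFlatCharted ψ σ` amount to interior charts alone (constructors `of_interior`), the
«open ends» are vacuous and the «compact core» is `S` itself, so every one-variable theorem of the tree applies with NO puncture hypotheses: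
* §1 **`IsLocallyCharted.of_interior`**, **`IsLocallyFlatCharted.of_interior`** (no ends: interior charts suffice).
* §2 THM 1.1, ALGEBRAICITY HALF: **`IsLocallyCharted.hodgeLocusOfNormLe_eq_univ_or_finite_of_compactSpace`** (+ `tensorSpace`, `hom`): each Hodge locus
  of bounded norm is ALL of `S` or FINITE; FINITENESS HALF: **`IsLocallyCharted.exists_forall_finite_and_ncard_hodgeClassesOfNormLe_le_of_compactSpace`**.
* §3 COR 1.3: **`IsLocallyFlatCharted.determinationLocus_eq_univ_or_finite_of_compactSpace`** (+ `tensorSpace`), and for FINITE COLLECTIONS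
  **`simultaneousDeterminationLocus_eq_univ_or_finite_of_compactSpace`**.

HONEST SCOPE: `dim S = 1`, `S` compact; the interior charts (holomorphy of the period map; flat frames for Cor. 1.3) are hypotheses.

## References

* [CattaniDeligneKaplan1995] E. Cattani, P. Deligne, A. Kaplan, *On the locus of Hodge classes*, J. Amer. Math. Soc. 8 (1995) 483–506: §1, Thm. 1.1,
  Cor. 1.2, Cor. 1.3 (p. 484), «Proof of 1.5 ⟹ 1.1» (p. 485).
* [MoonenOort2013Torelli] B. Moonen, F. Oort, *The Torelli locus and special subvarieties*, Handbook of Moduli II (2013), §3 Def. 4, Rem. 5 (arXiv p. 9).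
* [FritzscheGrauert2002] K. Fritzsche, H. Grauert, *From Holomorphic Functions to Complex Manifolds*, GTM 213 (2002), Ch. I §8 (identity theorem,
  coordinate discs).
* [Deligne1982HodgeCycles] P. Deligne, *Hodge cycles on abelian varieties*, LNM 900 (1982), I §3, 3.1–3.4 (tensor spaces `T^{a,b}`).
-/

noncomputable section

open scoped TensorProduct
open _root_.Topology _root_.Filter Set

universe u

namespace Literature.AlgebraicGeometry

open Motives HodgeTheory Topology

namespace Motives.VHSData

variable {S : Type} [TopologicalSpace S] {k k₁ k₂ : ℤ} {D : VHSData S k}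
variable {α ι : Type*} {ψ : α → OpenPartialHomeomorph S ℂ} {σ : ι → ℂ → S}

/-! ## §1 No ends: interior charts suffice -/

/-- **With NO ends (`ι` empty), interior charts on coordinate balls around every point make `D` locally charted.**
[cite: CattaniDeligneKaplan1995, §1 (p. 484)] -/
theorem IsLocallyCharted.of_interior [IsEmpty ι]
    (hint : ∀ a, ∀ x ∈ (ψ a).source, ∃ r > 0, Metric.ball (ψ a x) r ⊆ (ψ a).target ∧
      ∃ (V : Type) (_ : AddCommGroup V) (_ : Module ℚ V) (_ : FiniteDimensional ℚ V) (H₀ : HodgeStructure V k) (P₀ : H₀.Polarization),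
        Nonempty (D.InteriorChart (restrBall (ψ a) x r) P₀)) :
    D.IsLocallyCharted ψ σ :=
  ⟨hint, fun i => isEmptyElim i⟩

/-- **With NO ends, FLAT interior charts on coordinate balls around every point make `D` locally flat-charted.**
[cite: CattaniDeligneKaplan1995, §1 and Cor. 1.3 (p. 484)] -/
theorem IsLocallyFlatCharted.of_interior [IsEmpty ι]
    (hint : ∀ a, ∀ x ∈ (ψ a).source, ∃ r > 0, Metric.ball (ψ a x) r ⊆ (ψ a).target ∧
      ∃ (V : Type) (_ : AddCommGroup V) (_ : Module ℚ V) (_ : FiniteDimensional ℚ V) (H₀ : HodgeStructure V k) (P₀ : H₀.Polarization)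
        (C : D.InteriorChart (restrBall (ψ a) x r) P₀), C.IsFlat) :
    D.IsLocallyFlatCharted ψ σ :=
  ⟨hint, fun i => isEmptyElim i⟩

/-- With no ends the «compact core» hypothesis holds with core `S` itself (`S` compact). [cite: CattaniDeligneKaplan1995, «Proof of 1.5 ⟹ 1.1» (p. 485)] -/
theorem exists_isCompact_core_of_compactSpace [CompactSpace S] (A' : ι → ℝ) :
    ∃ K₀ : Set S, IsCompact K₀ ∧ K₀ ∪ ⋃ i, σ i '' {z : ℂ | A' i < z.im} = univ :=
  ⟨univ, isCompact_univ, univ_union _⟩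

/-! ## §2 Theorem 1.1 over a compact base: everything or finite; finitely many classes per point, uniformly -/

namespace IsLocallyCharted

/-- **CDK THEOREM 1.1 ∕ COROLLARY 1.2 OVER A COMPACT ONE-DIMENSIONAL BASE**: `S` compact, preconnected, covered by the discs `ψ a`; `D` locally charted
(no ends); `p + p = k`.  Then **every Hodge locus of bounded norm `hodgeLocusOfNormLe D p K` is ALL of `S` or FINITE.**
[cite: CattaniDeligneKaplan1995, §1, Thm. 1.1, Cor. 1.2 (p. 484)] [cite: FritzscheGrauert2002, Ch. I §8] -/
theorem hodgeLocusOfNormLe_eq_univ_or_finite_of_compactSpace [CompactSpace S] [PreconnectedSpace S] [IsEmpty ι] (h : D.IsLocallyCharted ψ σ)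
    {p : ℤ} (hpk : p + p = k) (K : ℤ) (hcov : ∀ x : S, ∃ a, x ∈ (ψ a).source) :
    D.hodgeLocusOfNormLe p K = univ ∨ (D.hodgeLocusOfNormLe p K).Finite :=
  h.hodgeLocusOfNormLe_eq_univ_or_finite hpk K hcov (fun i => isEmptyElim i) (fun i => isEmptyElim i)
    fun A' _ => exists_isCompact_core_of_compactSpace A'

/-- **THEOREM 1.1 OVER A COMPACT BASE FOR EVERY TENSOR SPACE `T^{a,b}D`.** [cite: CattaniDeligneKaplan1995, §1 and Thm. 1.1 (p. 484)]
[cite: Deligne1982HodgeCycles, I §3, 3.1–3.4] -/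
theorem hodgeLocusOfNormLe_tensorSpace_eq_univ_or_finite_of_compactSpace [CompactSpace S] [PreconnectedSpace S] [IsEmpty ι]
    (h : D.IsLocallyCharted ψ σ) (a b : ℕ) {p : ℤ} (hpk : p + p = (a : ℤ) * k + (b : ℤ) * (-k)) (K : ℤ) (hcov : ∀ x : S, ∃ a, x ∈ (ψ a).source) :
    (D.tensorSpace a b).hodgeLocusOfNormLe p K = univ ∨ ((D.tensorSpace a b).hodgeLocusOfNormLe p K).Finite :=
  (h.tensorSpace a b).hodgeLocusOfNormLe_eq_univ_or_finite_of_compactSpace hpk K hcov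

/-- **THEOREM 1.1 OVER A COMPACT BASE FOR THE MORPHISM LOCUS `Hom(D₁, D₂)`.** [cite: CattaniDeligneKaplan1995, §1 and Thm. 1.1 (p. 484)] -/
theorem hodgeLocusOfNormLe_hom_eq_univ_or_finite_of_compactSpace [CompactSpace S] [PreconnectedSpace S] [IsEmpty ι] {D₁ : VHSData S k₁}
    {D₂ : VHSData S k₂} (h₁ : D₁.IsLocallyCharted ψ σ) (h₂ : D₂.IsLocallyCharted ψ σ) {p : ℤ} (hpk : p + p = k₂ - k₁) (K : ℤ)
    (hcov : ∀ x : S, ∃ a, x ∈ (ψ a).source) :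
    (D₁.hom D₂).hodgeLocusOfNormLe p K = univ ∨ ((D₁.hom D₂).hodgeLocusOfNormLe p K).Finite :=
  (h₁.hom h₂).hodgeLocusOfNormLe_eq_univ_or_finite_of_compactSpace hpk K hcov

/-- **THEOREM 1.1, FINITENESS HALF, OVER A COMPACT BASE**: a uniform bound on the number of integral Hodge classes of type `(p,p)` with `Q(u,u) ≤ K`
per point. [cite: CattaniDeligneKaplan1995, §1 and Thm. 1.1 (p. 484)] -/
theorem exists_forall_finite_and_ncard_hodgeClassesOfNormLe_le_of_compactSpace [CompactSpace S] [IsEmpty ι] (h : D.IsLocallyCharted ψ σ)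
    {p : ℤ} (hpk : p + p = k) (K : ℤ) (hcov : ∀ x : S, ∃ a, x ∈ (ψ a).source) :
    ∃ N : ℕ, ∀ s : S,
      {u : D.VZ.fiber s | D.IsHodgeAt s p u ∧ (D.form s).form (D.toRat s u) (D.toRat s u) ≤ (K : ℚ)}.Finite ∧
        {u : D.VZ.fiber s | D.IsHodgeAt s p u ∧ (D.form s).form (D.toRat s u) (D.toRat s u) ≤ (K : ℚ)}.ncard ≤ N :=
  haveI : Finite ι := Finite.of_subsingleton
  h.exists_forall_finite_and_ncard_hodgeClassesOfNormLe_le hpk K hcov (fun i => isEmptyElim i) fun A' _ => exists_isCompact_core_of_compactSpace A'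

end IsLocallyCharted

/-! ## §3 Corollary 1.3 over a compact base: one class, tensor spaces, finite collections -/

namespace IsLocallyFlatCharted

/-- **CDK COROLLARY 1.3 OVER A COMPACT ONE-DIMENSIONAL BASE**: `S` compact, preconnected, covered by the discs; `D` locally FLAT-charted (no ends);
`p + p = k`, `u₀ ∈ V_ℤ,s₀`.  Then **the set of `t` where SOME determination `γ · u₀` is of type `(p,p)` is ALL of `S` or FINITE.**
[cite: CattaniDeligneKaplan1995, Cor. 1.3 (p. 484)] [cite: FritzscheGrauert2002, Ch. I §8] -/
theorem determinationLocus_eq_univ_or_finite_of_compactSpace [CompactSpace S] [PreconnectedSpace S] [IsEmpty ι] (h : D.IsLocallyFlatCharted ψ σ)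
    {p : ℤ} (hpk : p + p = k) {s₀ : S} (u₀ : D.VZ.fiber s₀) (hcov : ∀ x : S, ∃ a, x ∈ (ψ a).source) :
    {t : S | ∃ γ : Path.Homotopic.Quotient s₀ t, D.IsHodgeAt t p (D.VZ.transport γ u₀)} = univ ∨
      {t : S | ∃ γ : Path.Homotopic.Quotient s₀ t, D.IsHodgeAt t p (D.VZ.transport γ u₀)}.Finite :=
  h.determinationLocus_eq_univ_or_finite hpk u₀ hcov (fun i => isEmptyElim i) (fun i => isEmptyElim i)
    (fun A' _ => exists_isCompact_core_of_compactSpace A') fun i => isEmptyElim i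

/-- **COROLLARY 1.3 OVER A COMPACT BASE FOR EVERY TENSOR SPACE `T^{a,b}D`.** [cite: CattaniDeligneKaplan1995, Cor. 1.3 (p. 484)]
[cite: Deligne1982HodgeCycles, I §3, 3.1–3.4] -/
theorem determinationLocus_tensorSpace_eq_univ_or_finite_of_compactSpace [CompactSpace S] [PreconnectedSpace S] [IsEmpty ι]
    (h : D.IsLocallyFlatCharted ψ σ) (a b : ℕ) {p : ℤ} (hpk : p + p = (a : ℤ) * k + (b : ℤ) * (-k)) {s₀ : S}
    (u₀ : (D.tensorSpace a b).VZ.fiber s₀) (hcov : ∀ x : S, ∃ a, x ∈ (ψ a).source) :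
    {t : S | ∃ γ : Path.Homotopic.Quotient s₀ t, (D.tensorSpace a b).IsHodgeAt t p ((D.tensorSpace a b).VZ.transport γ u₀)} = univ ∨
      {t : S | ∃ γ : Path.Homotopic.Quotient s₀ t, (D.tensorSpace a b).IsHodgeAt t p ((D.tensorSpace a b).VZ.transport γ u₀)}.Finite :=
  (h.tensorSpace a b).determinationLocus_eq_univ_or_finite_of_compactSpace hpk u₀ hcov

end IsLocallyFlatCharted

/-- **COROLLARY 1.3 OVER A COMPACT BASE FOR A FINITE COLLECTION OF CLASSES** of finitely many locally flat-charted variations `D m` (one path class for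
all; Moonen–Oort's Hodge loci): everything or finite. [cite: CattaniDeligneKaplan1995, Cor. 1.3 (p. 484)]
[cite: MoonenOort2013Torelli, §3 Def. 4 and Rem. 5 (arXiv p. 9)] -/
theorem simultaneousDeterminationLocus_eq_univ_or_finite_of_compactSpace [CompactSpace S] [PreconnectedSpace S] [IsEmpty ι] {ι' : Type*}
    [Finite ι'] {k' : ι' → ℤ} {D' : (m : ι') → VHSData S (k' m)} (h : ∀ m, (D' m).IsLocallyFlatCharted ψ σ) {p : ι' → ℤ}
    (hpk : ∀ m, p m + p m = k' m) {s₀ : S} (u : (m : ι') → (D' m).VZ.fiber s₀) (hcov : ∀ x : S, ∃ a, x ∈ (ψ a).source) :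
    {t : S | ∃ γ : Path.Homotopic.Quotient s₀ t, ∀ m, (D' m).IsHodgeAt t (p m) ((D' m).VZ.transport γ (u m))} = univ ∨
      {t : S | ∃ γ : Path.Homotopic.Quotient s₀ t, ∀ m, (D' m).IsHodgeAt t (p m) ((D' m).VZ.transport γ (u m))}.Finite :=
  simultaneousDeterminationLocus_eq_univ_or_finite h hpk u hcov (fun i => isEmptyElim i) (fun i => isEmptyElim i)
    (fun A' _ => exists_isCompact_core_of_compactSpace A') fun i => isEmptyElim i

end Motives.VHSData

end Literature.AlgebraicGeometry

end
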